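import Mathlib.Analysis.InnerProductSpace.PiL2
import Mathlib.Analysis.InnerProductSpace.Projection.Reflection
import Mathlib.Analysis.InnerProductSpace.Projection.FiniteDimensional
import Mathlib.Data.List.GetD
import Literature.Geometry.DiscreteGeometry.KissingPatterns
import HarnessLib

/-!
# Frames, rational isometries and tuple closeness for shell censuses

Topic `Literature/Geometry/DiscreteGeometry`; part 1 of 4 of the Lean-side REPLAYER for the
gapped-shell census certificate (definition request `defn-ShellCensusReplay` for item
`stmt-AtomisticToContinuum-15929` = crux `ShellCensus` of route
`AtomisticToContinuum/Crystallization/GappedShellCensus`; parts 2–4 are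
`ShellCensusReplay.lean` (certificate language, checker, text decoder), `ShellCensusReplaySound.lean`
(soundness of the checker) and `ShellCensusTwelve.lean` (the twelve-neighbour instance and the
theorem in the form of the route statement)). This file holds the GEOMETRIC facts the soundness
proof needs — none of them numerical, no facts, no axioms:

* `exists_frame`: any tuple of points of `ℝ³` is carried by a linear isometry (three Mathlib
  reflections, `Submodule.reflection_sub`) into the FRAME `t i₀ = (0, 0, ‖t i₀‖)`,
  `t i₁ = (x, 0, z)` with `x ≥ 0`, `(t i₂).y ≥ 0` — the normalisation "`v₁` on the `z`-axis, `v₂`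
  in the `xz`-plane" that removes the `O(3)` symmetry before a box search;
* `qpt`, `rotLin` / `rotIso`: a `3 × 3` RATIONAL matrix that is exactly orthogonal (`matOrthoB`,
  decided in `ℚ`) acts as a linear isometry (`LinearMap.isometryOfInner`) and acts on rational
  points by rational arithmetic (`rotLin_qpt`) — how an `accept` leaf places a pattern;
* `TupleClose η t p` (`∃` isometry `A`, `∃` relabelling `σ`, `∀ k, dist (t k) (A (p (σ k))) ≤ η`),
  its invariance under relabelling and isometries of `t`, and the bridge
  `shellCloseTo_of_tupleClose` to `ShellCloseTo η (image t) (image p)` (`KissingPatterns.lean`)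
  for injective tuples; `exists_tuple_of_card` goes back from an `n`-point set to a tuple;
* `permOK` / `papp` / `permOf`: permutations of `Fin n` given as lists of images (certificate data).

## References
* R. E. Moore, *Interval Analysis*, Prentice-Hall (1966), §4.4 (refinement / exclusion by
  subdivision) — the box search these frames serve. [cite: Moore1966, §4.4]
* O. R. Musin, A. S. Tarasov, *The strong thirteen spheres problem*, Discrete Comput. Geom. 48
  (2012), §4 — the model computer classification of spherical point configurations (contact
  graphs enumerated, then eliminated by certified bounds). [cite: MusinTarasov2012, §4]
-/

noncomputable section

namespace Literature.Geometry.DiscreteGeometry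

open Finset

/-- Euclidean `3`-space. -/
local notation "E3" => EuclideanSpace ℝ (Fin 3)

namespace ShellCensus

/-! ### Frames -/

open scoped RealInnerProductSpace

/-- The standard basis vector `eᵢ` of `ℝ³`. [folklore] -/
noncomputable def bv (i : Fin 3) : E3 := EuclideanSpace.single i (1 : ℝ)

/-- Coordinates of `eᵢ`. [folklore] -/
@[simp] theorem bv_apply (i j : Fin 3) : bv i j = if j = i then 1 else 0 := by
  simp [bv, PiLp.single_apply]

/-- `‖eᵢ‖ = 1`. [folklore] -/
@[simp] theorem norm_bv (i : Fin 3) : ‖bv i‖ = 1 := by simp [bv]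

/-- `⟪eᵢ, x⟫ = xᵢ`. [folklore] -/
@[simp] theorem inner_bv_left (i : Fin 3) (x : E3) : ⟪bv i, x⟫ = x i := by
  simp [bv, EuclideanSpace.inner_single_left]

/-- The reflection `x ↦ (x₀, −x₁, x₂)` in the plane `x₁ = 0`. [folklore] -/
noncomputable def flipY : E3 ≃ₗᵢ[ℝ] E3 :=
  LinearIsometryEquiv.piLpCongrRight 2 fun i : Fin 3 =>
    if i = 1 then LinearIsometryEquiv.neg ℝ else LinearIsometryEquiv.refl ℝ ℝ

/-- Coordinates of `flipY x`. [folklore] -/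
theorem flipY_apply (x : E3) (j : Fin 3) : flipY x j = if j = 1 then -x j else x j := by
  simp only [flipY, LinearIsometryEquiv.piLpCongrRight_apply]
  split_ifs with h
  · subst h; simp
  · fin_cases j <;> simp_all

/-- **Frame normalisation.** For any tuple of points of `ℝ³` with `t i₀ ≠ 0` there is a linear
isometry putting `t i₀` on the positive `z`-axis, `t i₁` in the half-plane `{y = 0, x ≥ 0}` and
`t i₂` in the half-space `{y ≥ 0}` (three reflections). [folklore] -/
theorem exists_frame {ι : Type*} (t : ι → E3) (i₀ i₁ i₂ : ι) :
    ∃ A : E3 ≃ₗᵢ[ℝ] E3, A (t i₀) 0 = 0 ∧ A (t i₀) 1 = 0 ∧ A (t i₀) 2 = ‖t i₀‖ ∧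
      A (t i₁) 1 = 0 ∧ 0 ≤ A (t i₁) 0 ∧ 0 ≤ A (t i₂) 1 := by
  -- step 1: put `t i₀` on the nonnegative `z`-axis
  set v : E3 := t i₀ with hv
  set r : ℝ := ‖v‖ with hr
  have hrpos : 0 ≤ r := norm_nonneg v
  set R1 : E3 ≃ₗᵢ[ℝ] E3 := Submodule.reflection (ℝ ∙ (v - r • bv 2))ᗮ with hR1
  have hR1v : R1 v = r • bv 2 :=
    Submodule.reflection_sub (by rw [norm_smul, norm_bv, mul_one, Real.norm_of_nonneg hrpos])
  -- step 2: rotate about the `z`-axis (a reflection fixing `e₂`) to put `t i₁` in the `xz`-plane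
  set u : E3 := R1 (t i₁) with hu
  set w : E3 := u - u 2 • bv 2 with hw
  set ρ : ℝ := ‖w‖ with hρ
  set R2 : E3 ≃ₗᵢ[ℝ] E3 := Submodule.reflection (ℝ ∙ (w - ρ • bv 0))ᗮ with hR2
  have hR2w : R2 w = ρ • bv 0 :=
    Submodule.reflection_sub (by rw [norm_smul, norm_bv, mul_one, Real.norm_of_nonneg (norm_nonneg _)])
  have hR2e : R2 (bv 2) = bv 2 := by
    apply Submodule.reflection_mem_subspace_eq_self
    rw [Submodule.mem_orthogonal_singleton_iff_inner_left, inner_bv_left]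
    simp [hw]
  have hR2u : R2 u = ρ • bv 0 + u 2 • bv 2 := by
    have : u = w + u 2 • bv 2 := by rw [hw]; abel
    rw [this, map_add, hR2w, map_smul, hR2e]
    simp [hw]
  have hR2v : R2 (r • bv 2) = r • bv 2 := by rw [map_smul, hR2e]
  -- step 3: possibly flip `y`
  set p : E3 := R2 (R1 (t i₂)) with hp
  by_cases hy : 0 ≤ p 1
  · refine ⟨R1.trans R2, ?_, ?_, ?_, ?_, ?_, ?_⟩ <;>
      simp only [LinearIsometryEquiv.trans_apply]
    · rw [hR1v, hR2v]; simp
    · rw [hR1v, hR2v]; simp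
    · rw [hR1v, hR2v]; simp
    · rw [hR2u]; simp
    · rw [hR2u]; simpa using hρ ▸ norm_nonneg w
    · exact hy
  · refine ⟨(R1.trans R2).trans flipY, ?_, ?_, ?_, ?_, ?_, ?_⟩ <;>
      simp only [LinearIsometryEquiv.trans_apply, flipY_apply]
    · rw [hR1v, hR2v]; simp
    · rw [hR1v, hR2v]; simp
    · rw [hR1v, hR2v]; simp
    · rw [hR2u]; simp
    · rw [hR2u]; simpa using hρ ▸ norm_nonneg w
    · simp only [if_true]
      linarith [lt_of_not_ge hy]

/-! ### Rational points -/

/-- A rational point of `ℝ³`. [folklore] -/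
def qpt (a : ℚ × ℚ × ℚ) : E3 := !₂[(a.1 : ℝ), (a.2.1 : ℝ), (a.2.2 : ℝ)]

/-- Coordinates of `qpt`. [folklore] -/
@[simp] theorem qpt_apply_zero (a : ℚ × ℚ × ℚ) : qpt a 0 = a.1 := rfl
/-- Coordinates of `qpt`. [folklore] -/
@[simp] theorem qpt_apply_one (a : ℚ × ℚ × ℚ) : qpt a 1 = a.2.1 := rfl
/-- Coordinates of `qpt`. [folklore] -/
@[simp] theorem qpt_apply_two (a : ℚ × ℚ × ℚ) : qpt a 2 = a.2.2 := rfl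


/-! ### Rational orthogonal matrices as isometries -/

/-- Entry `(i, j)` of a `3 × 3` rational matrix stored row-major as a list of nine entries
(junk `0` beyond the list). [folklore] -/
def ment (M : List ℚ) (i j : ℕ) : ℚ := M.getD (3 * i + j) 0

/-- Exact orthogonality test `Mᵀ M = 1` in rational arithmetic. [folklore] -/
def matOrthoB (M : List ℚ) : Bool :=
  (List.range 3).all fun i => (List.range 3).all fun j =>
    decide (ment M 0 i * ment M 0 j + ment M 1 i * ment M 1 j + ment M 2 i * ment M 2 j =
      if i = j then 1 else 0)

/-- The matrix applied to a rational point. [folklore] -/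
def rotQ (M : List ℚ) (a : ℚ × ℚ × ℚ) : ℚ × ℚ × ℚ :=
  (ment M 0 0 * a.1 + ment M 0 1 * a.2.1 + ment M 0 2 * a.2.2,
   ment M 1 0 * a.1 + ment M 1 1 * a.2.1 + ment M 1 2 * a.2.2,
   ment M 2 0 * a.1 + ment M 2 1 * a.2.1 + ment M 2 2 * a.2.2)

/-- The matrix as a linear endomorphism of `ℝ³`. [folklore] -/
noncomputable def rotLin (M : List ℚ) : E3 →ₗ[ℝ] E3 where
  toFun v := !₂[(ment M 0 0 : ℝ) * v 0 + ment M 0 1 * v 1 + ment M 0 2 * v 2,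
    (ment M 1 0 : ℝ) * v 0 + ment M 1 1 * v 1 + ment M 1 2 * v 2,
    (ment M 2 0 : ℝ) * v 0 + ment M 2 1 * v 1 + ment M 2 2 * v 2]
  map_add' v w := by
    ext i; fin_cases i <;> simp <;> ring
  map_smul' c v := by
    ext i; fin_cases i <;> simp <;> ring

/-- Coordinates of `rotLin M v`. [folklore] -/
@[simp] theorem rotLin_apply_zero (M : List ℚ) (v : E3) :
    rotLin M v 0 = (ment M 0 0 : ℝ) * v 0 + ment M 0 1 * v 1 + ment M 0 2 * v 2 := rfl
/-- Coordinates of `rotLin M v`. [folklore] -/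
@[simp] theorem rotLin_apply_one (M : List ℚ) (v : E3) :
    rotLin M v 1 = (ment M 1 0 : ℝ) * v 0 + ment M 1 1 * v 1 + ment M 1 2 * v 2 := rfl
/-- Coordinates of `rotLin M v`. [folklore] -/
@[simp] theorem rotLin_apply_two (M : List ℚ) (v : E3) :
    rotLin M v 2 = (ment M 2 0 : ℝ) * v 0 + ment M 2 1 * v 1 + ment M 2 2 * v 2 := rfl

/-- `rotLin` acts on rational points by `rotQ`. [folklore] -/
theorem rotLin_qpt (M : List ℚ) (a : ℚ × ℚ × ℚ) : rotLin M (qpt a) = qpt (rotQ M a) := by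
  ext i
  fin_cases i
  · simp only [Fin.zero_eta, Fin.isValue, rotLin_apply_zero, qpt_apply_zero, qpt_apply_one,
      qpt_apply_two, rotQ]; push_cast; ring
  · simp only [Fin.mk_one, Fin.isValue, rotLin_apply_one, qpt_apply_zero, qpt_apply_one,
      qpt_apply_two, rotQ]; push_cast; ring
  · simp only [Fin.reduceFinMk, Fin.isValue, rotLin_apply_two, qpt_apply_zero, qpt_apply_one,
      qpt_apply_two, rotQ]; push_cast; ring

/-- One orthogonality relation, read in `ℝ`. [folklore] -/
theorem ortho_entry {M : List ℚ} (h : matOrthoB M = true) (i j : Fin 3) :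
    (ment M 0 i : ℝ) * ment M 0 j + ment M 1 i * ment M 1 j + ment M 2 i * ment M 2 j =
      if (i : ℕ) = j then 1 else 0 := by
  have h' : ∀ i ∈ List.range 3, ∀ j ∈ List.range 3,
      ment M 0 i * ment M 0 j + ment M 1 i * ment M 1 j + ment M 2 i * ment M 2 j =
        if i = j then 1 else 0 := by
    simpa [matOrthoB, List.all_eq_true] using h
  have := h' i (List.mem_range.2 i.2) j (List.mem_range.2 j.2)
  split_ifs at this ⊢ <;> exact_mod_cast this

/-- An exactly orthogonal rational matrix preserves inner products. [folklore] -/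
theorem inner_rotLin {M : List ℚ} (h : matOrthoB M = true) (x y : E3) :
    ⟪rotLin M x, rotLin M y⟫ = ⟪x, y⟫ := by
  have e00 := ortho_entry h 0 0
  have e11 := ortho_entry h 1 1
  have e22 := ortho_entry h 2 2
  have e01 := ortho_entry h 0 1
  have e02 := ortho_entry h 0 2
  have e12 := ortho_entry h 1 2
  norm_num at e00 e11 e22 e01 e02 e12
  simp only [PiLp.inner_apply, RCLike.inner_apply, conj_trivial, Fin.sum_univ_three,
    rotLin_apply_zero, rotLin_apply_one, rotLin_apply_two]
  linear_combination (y 0 * x 0) * e00 + (y 1 * x 1) * e11 + (y 2 * x 2) * e22 +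
    (y 0 * x 1 + y 1 * x 0) * e01 + (y 0 * x 2 + y 2 * x 0) * e02 + (y 1 * x 2 + y 2 * x 1) * e12

/-- **The linear isometry of an exactly orthogonal rational matrix.** [folklore] -/
noncomputable def rotIso (M : List ℚ) (h : matOrthoB M = true) : E3 →ₗᵢ[ℝ] E3 :=
  (rotLin M).isometryOfInner (inner_rotLin h)

/-- `rotIso` is `rotLin`. [folklore] -/
@[simp] theorem rotIso_apply (M : List ℚ) (h : matOrthoB M = true) (v : E3) :
    rotIso M h v = rotLin M v := rfl

/-! ### Closeness of tuples to patterns -/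

/-- **Tuple closeness**: after a linear isometry `A` and a relabelling `σ`, every point of `t` is
within `η` of the corresponding pattern point. [folklore] -/
def TupleClose {n : ℕ} (η : ℝ) (t p : Fin n → E3) : Prop :=
  ∃ (A : E3 →ₗᵢ[ℝ] E3) (σ : Equiv.Perm (Fin n)), ∀ k, dist (t k) (A (p (σ k))) ≤ η



/-- Tuple closeness is invariant under relabelling the tuple by a permutation. [folklore] -/
theorem TupleClose.of_comp_perm {n : ℕ} {η : ℝ} {t p : Fin n → E3} (σ : Equiv.Perm (Fin n))
    (h : TupleClose η (t ∘ σ) p) : TupleClose η t p := by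
  obtain ⟨A, τ, hτ⟩ := h
  refine ⟨A, σ.symm.trans τ, fun k => ?_⟩
  simpa using hτ (σ.symm k)

/-- Tuple closeness is invariant under a linear isometry applied to the tuple. [folklore] -/
theorem TupleClose.of_isometry_comp {n : ℕ} {η : ℝ} {t p : Fin n → E3} (B : E3 ≃ₗᵢ[ℝ] E3)
    (h : TupleClose η (fun k => B (t k)) p) : TupleClose η t p := by
  obtain ⟨A, τ, hτ⟩ := h
  refine ⟨B.symm.toLinearIsometry.comp A, τ, fun k => ?_⟩
  have := hτ k
  rwa [← B.symm.dist_map, B.symm_apply_apply] at this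

/-- **From tuple closeness to `ShellCloseTo`** of the underlying finite sets (injective tuples).
[folklore] -/
theorem shellCloseTo_of_tupleClose {n : ℕ} {η : ℝ} {t p : Fin n → E3}
    (ht : Function.Injective t) (hp : Function.Injective p) (h : TupleClose η t p) :
    ShellCloseTo η (univ.image t) (univ.image p) := by
  obtain ⟨A, σ, hσ⟩ := h
  refine ⟨A, ?_⟩
  classical
  -- the index of a point of `T = image t`
  have hidx : ∀ x : ↥(univ.image t), ∃ k, t k = x := fun x => by
    obtain ⟨k, -, hk⟩ := Finset.mem_image.1 x.2
    exact ⟨k, hk⟩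
  choose idx hidx using hidx
  have hmem : ∀ x : ↥(univ.image t), A (p (σ (idx x))) ∈ (univ.image p).image A := fun x =>
    Finset.mem_image_of_mem _ (Finset.mem_image_of_mem _ (Finset.mem_univ _))
  let f : ↥(univ.image t) → ↥((univ.image p).image A) := fun x => ⟨A (p (σ (idx x))), hmem x⟩
  have hf : Function.Injective f := by
    intro x y hxy
    have h1 : A (p (σ (idx x))) = A (p (σ (idx y))) := congrArg Subtype.val hxy
    have h2 : idx x = idx y := σ.injective (hp (A.injective h1))
    apply Subtype.ext
    rw [← hidx x, ← hidx y, h2]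
  have hcard : Fintype.card ↥(univ.image t) = Fintype.card ↥((univ.image p).image A) := by
    simp only [Fintype.card_coe]
    rw [Finset.card_image_of_injective _ A.injective, Finset.card_image_of_injective _ ht,
      Finset.card_image_of_injective _ hp]
  have hbij : Function.Bijective f := (Fintype.bijective_iff_injective_and_card f).2 ⟨hf, hcard⟩
  refine ⟨Equiv.ofBijective f hbij, fun x => ?_⟩
  change dist (x : E3) (A (p (σ (idx x)))) ≤ η
  rw [← hidx x]
  exact hσ (idx x)

/-! ### Permutations given as lists -/

/-- `π` lists the images of `0, …, n−1` under a permutation of `{0, …, n−1}`. [folklore] -/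
def permOK (n : ℕ) (π : List ℕ) : Bool :=
  (π.length == n) && π.all (· < n) && decide π.Nodup

/-- The image of `k` (junk `0` out of range). [folklore] -/
def papp (π : List ℕ) (k : ℕ) : ℕ := π.getD k 0

/-- Images are in range. [folklore] -/
theorem papp_lt {n : ℕ} {π : List ℕ} (h : permOK n π = true) {k : ℕ} (hk : k < n) : papp π k < n := by
  simp only [permOK, Bool.and_eq_true, beq_iff_eq, List.all_eq_true, decide_eq_true_eq] at h
  obtain ⟨⟨hlen, hall⟩, -⟩ := h
  unfold papp
  rw [List.getD_eq_getElem _ _ (hlen ▸ hk)]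
  exact hall _ (List.getElem_mem _)

/-- The permutation of `Fin n` encoded by an accepted list. [folklore] -/
noncomputable def permOf {n : ℕ} {π : List ℕ} (h : permOK n π = true) : Equiv.Perm (Fin n) :=
  Equiv.ofBijective (fun k : Fin n => (⟨papp π k, papp_lt h k.2⟩ : Fin n)) (by
    have hinj : Function.Injective fun k : Fin n => (⟨papp π k, papp_lt h k.2⟩ : Fin n) := by
      simp only [permOK, Bool.and_eq_true, beq_iff_eq, List.all_eq_true, decide_eq_true_eq] at h
      obtain ⟨⟨hlen, -⟩, hnd⟩ := h
      intro a b hab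
      have hab' : papp π a = papp π b := congrArg Fin.val hab
      unfold papp at hab'
      rw [List.getD_eq_getElem _ _ (hlen ▸ a.2), List.getD_eq_getElem _ _ (hlen ▸ b.2)] at hab'
      exact Fin.ext ((List.Nodup.getElem_inj_iff hnd).1 hab')
    exact (Finite.injective_iff_bijective).1 hinj)

/-- `permOf` maps `k` to `π[k]`. [folklore] -/
@[simp] theorem permOf_apply_val {n : ℕ} {π : List ℕ} (h : permOK n π = true) (k : Fin n) :
    ((permOf h k : Fin n) : ℕ) = papp π k := rfl

/-! ### Finite sets as tuples -/

/-- **From tuples to finite sets.** A finite set of `n` points is the image of an injective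
`n`-tuple. [folklore] -/
theorem exists_tuple_of_card {n : ℕ} (T : Finset E3) (hT : T.card = n) :
    ∃ t : Fin n → E3, Function.Injective t ∧ univ.image t = T := by
  classical
  let e : ↥T ≃ Fin n := T.equivFinOfCardEq hT
  refine ⟨fun k => (e.symm k : E3), fun a b hab => e.symm.injective (Subtype.ext hab), ?_⟩
  ext x
  simp only [Finset.mem_image, Finset.mem_univ, true_and]
  constructor
  · rintro ⟨k, rfl⟩
    exact (e.symm k).2
  · intro hx
    exact ⟨e ⟨x, hx⟩, by simp⟩

end ShellCensus

end Literature.Geometry.DiscreteGeometry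

end
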